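import Summits.ABC.ABC.Theses.CubicResolventAllowance
import Summits.ABC.ABC.Theorems.CubicResolventAllowanceResolventPayoff
import Literature.NumberTheory.CubicFields.BinaryCubicForms
import Literature.NumberTheory.NumberFields.CubicFieldExplicit
import Literature.NumberTheory.NumberFields.CubicFieldDedekindKummer
import Literature.NumberTheory.DiophantineGeometry.Conductor
import HarnessLib

/-!
# Stub-ideation k=3 (FAMILY 3 — probe the extremes), gen 4 — `stub_realCubic` of `IndexSzpiro` (stmt-ABC-22740)

THE SATURATING FAMILY.  Inside ONE totally real cubic field `K₄₉ = ℚ(ζ₇)⁺ = ℚ[t]/(t³+t²−2t−1)`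
(`d_K = 49`) the class `{E/ℚ : ψ₂ irreducible, resolvent field K₄₉}` contains the explicit infinite
family `W_{u,v} := curveOfForm F₄₉ u v = [0,0,0,−27H,−27G]` over the primitive points of the
cube curve `C : F₄₉(u,v) = u³+u²v−2uv²−v³ = w³` (`C ≅ E₇₈₄ : y²=x³+784`, rank 1; the covariant map
`(u,v,w) ↦ (4H/w², 4G/w³)` lands in `E' : y² = x³ − 21168`, `E'(ℚ) = ℤ·(84,756)`, image = `{±mγ₁ : 3 ∤ m}`).
Along it `Δ_min = 2⁴·7²·w⁶`, `N = 2^{f₂}·7²·rad(w)` (kit j344622/j344624), so the Szpiro and index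
ratios tend to `6`: the exponent `6` of the stub is SHARP inside one field (T1) and, by `p`-adic
lifting in the elliptic divisibility sequence of `γ₁` (`p = 29`, order of appearance `5`, `3 ∤ 5·29^k`),
`ε` cannot be dropped inside one field either (T2).  Everything elaborates; `sorry` only in the
helper bodies `H2 … H7` (PROPOSALS, one prover cycle each except H6/H7); the assembly T1/T2/T3 is
kernel-checked modulo the helpers.  k2's `curveOfForm`/`hessEval`/`jacEval`/`curveOfForm_Δ`
(`StubIdeas2Sketch.lean`, unbuilt on the farm today) are mirrored verbatim in §2a with attribution.
-/

open Polynomial NumberField WeierstrassCurve Filter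
open Literature.NumberTheory.CubicFields
open Literature.NumberTheory.NumberFields Literature.NumberTheory.NumberFields.MonicCubic

namespace Summit.ABC.ABC.Cruxes.IndexSzpiro.StubIdeas3G4

/-! ## §0 The stub and its one-parameter version -/

/-- The stub, verbatim (`line2-birth.lean`, `stub_realCubic`). -/
def StubRealCubic : Prop :=
  ∀ ε : ℝ, 0 < ε → ∃ C : ℝ, ∀ (W : WeierstrassCurve ℚ) [W.IsElliptic] (K : Type) [Field K] [NumberField K],
    Irreducible W.twoTorsionPolynomial.toPoly → Module.finrank ℚ K = 3 →
    (∃ θ : K, aeval θ W.twoTorsionPolynomial.toPoly = 0) → 0 < NumberField.discr K →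
    (W.minimalDiscriminantNorm ℤ : ℝ) ≤ C * |(NumberField.discr K : ℝ)| * (W.conductorNorm ℤ : ℝ) ^ (6 + ε)

/-- `IndexSzpiroRealExp κ`: the real-irreducible-class index bound with conductor exponent `κ`. -/
def IndexSzpiroRealExp (κ : ℝ) : Prop :=
  ∃ C : ℝ, ∀ (W : WeierstrassCurve ℚ) [W.IsElliptic] (K : Type) [Field K] [NumberField K],
    Irreducible W.twoTorsionPolynomial.toPoly → Module.finrank ℚ K = 3 →
    (∃ θ : K, aeval θ W.twoTorsionPolynomial.toPoly = 0) → 0 < NumberField.discr K →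
    (W.minimalDiscriminantNorm ℤ : ℝ) ≤ C * |(NumberField.discr K : ℝ)| * (W.conductorNorm ℤ : ℝ) ^ κ

theorem stub_iff : StubRealCubic ↔ ∀ ε : ℝ, 0 < ε → IndexSzpiroRealExp (6 + ε) := Iff.rfl

/-- Monotonicity in the exponent (`N ≥ 1`, tree fact `conductorNorm_pos_holds`; `C ↦ max C 0`). -/
theorem indexSzpiroRealExp_mono {κ κ' : ℝ} (hle : κ ≤ κ') : IndexSzpiroRealExp κ → IndexSzpiroRealExp κ' := by
  rintro ⟨C, hC⟩
  refine ⟨max C 0, fun W _ K _ _ hirr h3 hθ hd => (hC W K hirr h3 hθ hd).trans ?_⟩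
  have hN : (1 : ℝ) ≤ (W.conductorNorm ℤ : ℝ) := by exact_mod_cast W.conductorNorm_pos_holds
  have h0 : 0 ≤ |(NumberField.discr K : ℝ)| := abs_nonneg _
  have hκ : 0 ≤ |(NumberField.discr K : ℝ)| * (W.conductorNorm ℤ : ℝ) ^ κ :=
    mul_nonneg h0 (Real.rpow_nonneg (by positivity) _)
  have hpow : (W.conductorNorm ℤ : ℝ) ^ κ ≤ (W.conductorNorm ℤ : ℝ) ^ κ' :=
    Real.rpow_le_rpow_of_exponent_le hN hle
  calc C * |(NumberField.discr K : ℝ)| * (W.conductorNorm ℤ : ℝ) ^ κ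
      = C * (|(NumberField.discr K : ℝ)| * (W.conductorNorm ℤ : ℝ) ^ κ) := by ring
    _ ≤ max C 0 * (|(NumberField.discr K : ℝ)| * (W.conductorNorm ℤ : ℝ) ^ κ) :=
        mul_le_mul_of_nonneg_right (le_max_left _ _) hκ
    _ ≤ max C 0 * (|(NumberField.discr K : ℝ)| * (W.conductorNorm ℤ : ℝ) ^ κ') :=
        mul_le_mul_of_nonneg_left (mul_le_mul_of_nonneg_left hpow h0) (le_max_right _ _)
    _ = max C 0 * |(NumberField.discr K : ℝ)| * (W.conductorNorm ℤ : ℝ) ^ κ' := by ring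

/-! ## §1 The field `K₄₉ = ℚ(ζ₇)⁺` -/

/-- `f₄₉ = X³ + X² − 2X − 1` (LMFDB 3.3.49.1). -/
theorem disc_f49 : disc 1 (-2) (-1) = 49 := by norm_num [disc]

theorem isUnit_of_disc49 : ∀ r e : ℤ, disc 1 (-2) (-1) = r ^ 2 * e → 2 < |e| → IsUnit r := by
  intro r e h he
  rw [disc_f49] at h
  have h3 : 3 ≤ |e| := he
  have hr2 : r ^ 2 * 3 ≤ 49 := by
    have : r ^ 2 * |e| = 49 := by rw [← abs_of_nonneg (sq_nonneg r), ← abs_mul, ← h]; norm_num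
    nlinarith [sq_nonneg r]
  have hr : -4 ≤ r ∧ r ≤ 4 := by constructor <;> nlinarith
  obtain ⟨h1, h2⟩ := hr
  rw [Int.isUnit_iff]
  interval_cases r <;> omega

theorem no_root_2 : ∀ r : ZMod 2, r ^ 3 + ((1 : ℤ) : ZMod 2) * r ^ 2 + ((-2 : ℤ) : ZMod 2) * r + ((-1 : ℤ) : ZMod 2) ≠ 0 := by
  decide

/-- `f₄₉` is irreducible (no root mod `2`: `2` is inert in `K₄₉`). -/
theorem irreducible_f49Q : Irreducible (polyQ 1 (-2) (-1)) :=
  haveI : Fact (Nat.Prime 2) := ⟨by norm_num⟩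
  irreducible_polyQ_of_no_root 2 no_root_2

/-- **`d_K = 49`** for every cubic number field containing a root of `f₄₉` (tree index criterion). -/
theorem discr_K49 {K : Type*} [Field K] [NumberField K] {t : K} (h3 : Module.finrank ℚ K = 3)
    (ht : aeval t (poly 1 (-2) (-1)) = 0) : NumberField.discr K = 49 := by
  rw [discr_eq_disc irreducible_f49Q ht h3 isUnit_of_disc49, disc_f49]

/-- A cubic number field containing a root of `f₄₉` exists (`ℚ[X]/(f₄₉)`; tree `exists_numberField_root`). -/
theorem exists_K49 : ∃ (K : Type) (_ : Field K) (_ : NumberField K),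
    Module.finrank ℚ K = 3 ∧ ∃ t : K, aeval t (poly 1 (-2) (-1)) = 0 := by
  obtain ⟨K, hF, hN, hdeg, θ, hθ, -⟩ := Summit.ABC.ABC.Theorems.exists_numberField_root
    (f := polyQ 1 (-2) (-1)) irreducible_f49Q (by rw [natDegree_polyQ]; norm_num)
    (by rw [natDegree_polyQ]) dvd_rfl
  refine ⟨K, hF, hN, by rw [hdeg, natDegree_polyQ], θ, ?_⟩
  rwa [polyQ, aeval_map_algebraMap] at hθ

/-! ## §2a Verbatim mirror of k2's family (`Cruxes/IndexSzpiro/StubIdeas2Sketch.lean`, ns `…StubIdeas2`) -/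

/-- k2 mirror: Hessian covariant `H_F(u,v)`. -/
def hessEval (F : BinaryCubic ℤ) (u v : ℤ) : ℤ :=
  (F.b ^ 2 - 3 * F.a * F.c) * u ^ 2 + (F.b * F.c - 9 * F.a * F.d) * u * v + (F.c ^ 2 - 3 * F.b * F.d) * v ^ 2

/-- k2 mirror: Jacobian covariant `G_F = F_u·H_v − F_v·H_u`. -/
def jacEval (F : BinaryCubic ℤ) (u v : ℤ) : ℤ :=
  (3 * F.a * u ^ 2 + 2 * F.b * u * v + F.c * v ^ 2) * ((F.b * F.c - 9 * F.a * F.d) * u + 2 * (F.c ^ 2 - 3 * F.b * F.d) * v) -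
    (F.b * u ^ 2 + 2 * F.c * u * v + 3 * F.d * v ^ 2) * (2 * (F.b ^ 2 - 3 * F.a * F.c) * u + (F.b * F.c - 9 * F.a * F.d) * v)

/-- k2 mirror: the syzygy `G² = 4H³ − 27·disc F·F²`. -/
theorem jacEval_sq (F : BinaryCubic ℤ) (u v : ℤ) :
    jacEval F u v ^ 2 = 4 * hessEval F u v ^ 3 - 27 * F.disc * F.eval u v ^ 2 := by
  simp only [jacEval, hessEval, BinaryCubic.eval, BinaryCubic.disc_eq]; ring

/-- k2 mirror: `E_{F,u,v} : y² = x³ − 27·H_F(u,v)·x − 27·G_F(u,v)`. -/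
def curveOfForm (F : BinaryCubic ℤ) (u v : ℤ) : WeierstrassCurve ℤ :=
  ⟨0, 0, 0, -27 * hessEval F u v, -27 * jacEval F u v⟩

section mirror
variable (F : BinaryCubic ℤ) (u v : ℤ)
theorem curveOfForm_b₂ : (curveOfForm F u v).b₂ = 0 := by
  simp only [curveOfForm, WeierstrassCurve.b₂]; ring
theorem curveOfForm_b₄ : (curveOfForm F u v).b₄ = -54 * hessEval F u v := by
  simp only [curveOfForm, WeierstrassCurve.b₄]; ring
theorem curveOfForm_b₆ : (curveOfForm F u v).b₆ = -108 * jacEval F u v := by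
  simp only [curveOfForm, WeierstrassCurve.b₆]; ring
theorem curveOfForm_b₈ : (curveOfForm F u v).b₈ = -(27 * hessEval F u v) ^ 2 := by
  simp only [curveOfForm, WeierstrassCurve.b₈]; ring
/-- k2 mirror: `c₄ = 2⁴3⁴·H` (so `p ∤ 6H ⇒ p ∤ c₄`: the multiplicativity test of H4). -/
theorem curveOfForm_c₄ : (curveOfForm F u v).c₄ = 1296 * hessEval F u v := by
  simp only [WeierstrassCurve.c₄, curveOfForm_b₂, curveOfForm_b₄]; ring
/-- k2 mirror: `Δ(E_{F,u,v}) = 2⁴·3¹²·disc F·F(u,v)²`. -/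
theorem curveOfForm_Δ : (curveOfForm F u v).Δ = 2 ^ 4 * 3 ^ 12 * F.disc * F.eval u v ^ 2 := by
  have h := jacEval_sq F u v
  simp only [WeierstrassCurve.Δ, curveOfForm_b₂, curveOfForm_b₄, curveOfForm_b₆, curveOfForm_b₈]
  linear_combination (-314928 : ℤ) * h
/-- `ψ₂(E_{F,u,v} / ℚ) = 4x³ − 108·H·x − 108·G`. -/
theorem twoTorsionPolynomial_curveOfForm :
    ((curveOfForm F u v).baseChange ℚ).twoTorsionPolynomial =
      ⟨4, 0, -108 * (hessEval F u v : ℚ), -108 * (jacEval F u v : ℚ)⟩ := by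
  have h2 := curveOfForm_b₂ F u v
  have h4 := curveOfForm_b₄ F u v
  have h6 := curveOfForm_b₆ F u v
  ext <;> simp [WeierstrassCurve.twoTorsionPolynomial, WeierstrassCurve.baseChange, h2, h4, h6] <;> ring
end mirror

/-! ## §2 The cube family over `F₄₉ = (1,1,−2,−1)` (index form of `ℤ[t] = 𝓞_{K₄₉}`) -/

/-- `F₄₉(u,v) = u³ + u²v − 2uv² − v³ = N_{K₄₉/ℚ}(u − v·t')`. -/
def F49 : BinaryCubic ℤ := ⟨1, 1, -2, -1⟩

theorem F49_disc : F49.disc = 49 := by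
  simp only [F49, BinaryCubic.disc_eq]; norm_num

theorem F49_eval (u v : ℤ) : F49.eval u v = u ^ 3 + u ^ 2 * v - 2 * u * v ^ 2 - v ^ 3 := by
  simp only [F49, BinaryCubic.eval]; ring

theorem hessEval_F49 (u v : ℤ) : hessEval F49 u v = 7 * (u ^ 2 + u * v + v ^ 2) := by
  simp only [hessEval, F49]; ring

theorem jacEval_F49 (u v : ℤ) : jacEval F49 u v = 7 * u ^ 3 + 105 * u ^ 2 * v + 84 * u * v ^ 2 - 7 * v ^ 3 := by
  simp only [jacEval, F49]; ring

/-- The class member attached to a point of the cube curve: `W_{u,v} = [0,0,0,−27H,−27G] / ℚ`. -/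
noncomputable def cubeCurve (u v : ℤ) : WeierstrassCurve ℚ := (curveOfForm F49 u v).baseChange ℚ

/-- H1 (PROVED). `Δ(W_{u,v}) = 2⁴·3¹²·7²·w⁶` on the cube curve `F₄₉(u,v) = w³`. -/
theorem cubeCurve_Δ_int {u v w : ℤ} (h : F49.eval u v = w ^ 3) :
    (curveOfForm F49 u v).Δ = 2 ^ 4 * 3 ^ 12 * 7 ^ 2 * w ^ 6 := by
  rw [curveOfForm_Δ, F49_disc, h]; ring

theorem cubeCurve_Δ {u v w : ℤ} (h : F49.eval u v = w ^ 3) :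
    (cubeCurve u v).Δ = ((2 ^ 4 * 3 ^ 12 * 7 ^ 2 * w ^ 6 : ℤ) : ℚ) := by
  rw [cubeCurve, baseChange, map_Δ, cubeCurve_Δ_int h, algebraMap_int_eq, eq_intCast]

theorem cubeCurve_isElliptic {u v w : ℤ} (hw : w ≠ 0) (h : F49.eval u v = w ^ 3) :
    (cubeCurve u v).IsElliptic :=
  ⟨by
    rw [cubeCurve_Δ h, isUnit_iff_ne_zero, Int.cast_ne_zero]
    exact mul_ne_zero (by norm_num) (pow_ne_zero 6 hw)⟩

/-- H2 (S/M). `gcd(w, 42) = 1` for a primitive cube point: `2, 3` are inert in `K₄₉` (`F₄₉(u,v) ≢ 0`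
mod `2`, `3` for `(u,v) ≢ (0,0)`), and `7 = 𝔭³` with `v₇(F₄₉(u,v)) ≤ 1` for coprime `(u,v)`
(`F₄₉ ≡ (u−2v)³ (mod 7)`, `F₄₉(2v+7s, v) = 7(v³ + 14sv² + 49s²v + 49s³)`).  Finite check mod `4·9·49`. -/
theorem cube_coprime_42 {u v w : ℤ} (huv : IsCoprime u v) (h : F49.eval u v = w ^ 3) : IsCoprime w 42 := by
  sorry

/-- H3a (M; k2 `eta_cubic`). `ψ₂(W_{u,v}) = 4x³ − 108Hx − 108G` is irreducible for `(u,v)` primitive: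
its roots are `−3ηᵢ`, `η = 3(uω+vθ) − (u+2v) ∉ ℚ`. -/
theorem cubeCurve_irreducible {u v : ℤ} (huv : IsCoprime u v) :
    Irreducible (cubeCurve u v).twoTorsionPolynomial.toPoly := by
  sorry

/-- H3b (PROVED; identity in `ℤ[t]/(f₄₉)`, certificate = the quotient polynomial). The explicit root of
`ψ₂(W_{u,v})` in ANY field containing a root `t` of `f₄₉`: `x₀ = 9v·t² + 9(u+v)·t + (3u − 12v)`
(`= −3η` under `ω ↦ −t, θ ↦ −(t²+t−2)`). -/
theorem cubeCurve_root {K : Type*} [Field K] [NumberField K] {t : K} (ht : aeval t (poly 1 (-2) (-1)) = 0)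
    (u v : ℤ) :
    aeval (9 * v * t ^ 2 + 9 * (u + v) * t + (3 * u - 12 * v) : K) (cubeCurve u v).twoTorsionPolynomial.toPoly = 0 := by
  have ht' : t ^ 3 + t ^ 2 - 2 * t - 1 = 0 := by
    have := theta_rel ht
    push_cast at this
    linear_combination this
  rw [cubeCurve, twoTorsionPolynomial_curveOfForm, hessEval_F49, jacEval_F49]
  simp only [Cubic.toPoly, map_add, map_mul, aeval_C, aeval_X_pow, aeval_X, map_pow, eq_ratCast]
  push_cast
  linear_combination ((2916 : K) * v ^ 3 * t ^ 3 + (8748 : K) * u * v ^ 2 * t ^ 2 + (5832 : K) * v ^ 3 * t ^ 2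
    + (8748 : K) * u ^ 2 * v * t + (11664 : K) * u * v ^ 2 * t + (-2916 : K) * v ^ 3 * t + (2916 : K) * u ^ 3
    + (5832 : K) * u ^ 2 * v + (-2916 : K) * u * v ^ 2 + (-2916 : K) * v ^ 3) * ht'

/-- H4/H5a (M; tree `isMinimalAt_of_lt_valuation_c₄`, `conductorExponent_eq_one_iff_holds`,
`factorization_minimalDiscriminantNorm`). LOCAL LAW ⇒ `w⁶ ∣ Δ_min`: for `p ∣ w` (so `p ∤ 42` by H2,
and `p ∤ H = 7(u²+uv+v²)` since `Res(F₄₉, u²+uv+v²) = 7`) the model is minimal and multiplicative at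
`p` with `ord_p Δ_min = 6·v_p(w)`, `f_p = 1`; data: `Δ_min = 2⁴·7²·w⁶` exactly (j344622). -/
theorem minimalDiscriminantNorm_ge {u v w : ℤ} (huv : IsCoprime u v) (h : F49.eval u v = w ^ 3) :
    w.natAbs ^ 6 ≤ (cubeCurve u v).minimalDiscriminantNorm ℤ := by
  sorry

/-- H5b (M; same local law + the caps `f₂ ≤ 8`, `f₃ ≤ 5`, `f₇ ≤ 2` of `conductorExponent_le_eight_holds`
& co., `factorization_conductorNorm`). `N(W_{u,v}) ≤ 2⁸·3⁵·7²·rad(w)`; data: `N = 2^{f₂}·7²·rad(w)`,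
`f₂ ∈ {2,3,4}`, `f₃ = 0`. -/
theorem conductorNorm_le {u v w : ℤ} (huv : IsCoprime u v) (h : F49.eval u v = w ^ 3) (hw : w ≠ 0) :
    (cubeCurve u v).conductorNorm ℤ ≤ 2 ^ 8 * 3 ^ 5 * 7 ^ 2 * UniqueFactorizationMonoid.radical w.natAbs := by
  sorry

/-- H6 (L). The cube curve has primitive points with `|w|` unbounded.  Certificate: `C ≅ E₇₈₄`
(`y² = x³ + 784`, rank 1, `E₇₈₄(ℚ) ≅ ℤ × ℤ/3`), 39 primitive points with `|w|` up to `10²⁶` (j344622);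
`|w|` = the denominator `e_m` of `mγ₁`, `γ₁ = (84,756) ∈ E'(ℚ) : y² = x³ − 21168`, `3 ∤ m`
(`e₅ = 29`, `e₇ = 13·127`, `e₈ = 2521`, `e₁₀ = 29·52051`, …).  Routes: (a) Mathlib group law on `E₇₈₄`
+ the explicit Rubin–Silverberg/Bennett–Yazdani birational map `ψ⁻¹ : E₇₈₄ → C` + a height-growth
identity; (b) keep as the named hypothesis `CubePointsUnbounded` (T1 is then conditional on it). -/
theorem cubePoints_unbounded : ∀ B : ℕ, ∃ u v w : ℤ, IsCoprime u v ∧ F49.eval u v = w ^ 3 ∧ (B : ℤ) < |w| := by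
  sorry

/-- H7 (XL today: formal group of `E'` at `p = 29`). `29`-POWERFUL MEMBERS: the points `m = 5·29^k`
(`3 ∤ m`, order of appearance of `29` in the EDS of `γ₁` is `5`) give primitive cube points with
`29^{k+1} ∣ w` (`v₂₉(e_{29m}) = v₂₉(e_m) + 1`; lifting verified numerically for `p = 2,3,5`, j344622 (c)). -/
theorem cubePoints_powerful : ∀ k : ℕ, ∃ u v w : ℤ, IsCoprime u v ∧ F49.eval u v = w ^ 3 ∧ w ≠ 0 ∧
    (29 : ℕ) ^ k * UniqueFactorizationMonoid.radical w.natAbs ≤ w.natAbs := by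
  sorry

/-! ## §3 Assembly (kernel-checked modulo H2–H7): the exponent `6` is sharp and `ε` cannot be dropped -/

/-- The common core of T1/T2: a primitive cube point yields a class member (over `K₄₉`, `d_K = 49`)
whose data violate nothing yet but satisfy `|w|⁶ ≤ C·49·(A·rad w)^κ`, `A = 2⁸3⁵7² = 3048192`.
Pure bookkeeping over H3–H5 (kernel-checked modulo their `sorry`s). -/
theorem family_bound {C κ : ℝ} (hκ : 0 ≤ κ)
    (hC : ∀ (W : WeierstrassCurve ℚ) [W.IsElliptic] (K : Type) [Field K] [NumberField K],
      Irreducible W.twoTorsionPolynomial.toPoly → Module.finrank ℚ K = 3 →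
      (∃ θ : K, aeval θ W.twoTorsionPolynomial.toPoly = 0) → 0 < NumberField.discr K →
      (W.minimalDiscriminantNorm ℤ : ℝ) ≤ C * |(NumberField.discr K : ℝ)| * (W.conductorNorm ℤ : ℝ) ^ κ)
    {u v w : ℤ} (huv : IsCoprime u v) (h : F49.eval u v = w ^ 3) (hw : w ≠ 0) :
    0 ≤ C ∧ (w.natAbs : ℝ) ^ (6 : ℕ) ≤
      C * 49 * ((3048192 : ℝ) * ((UniqueFactorizationMonoid.radical w.natAbs : ℕ) : ℝ)) ^ κ := by
  obtain ⟨K, _, _, hK3, t, ht⟩ := exists_K49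
  haveI := cubeCurve_isElliptic hw h
  have hd : NumberField.discr K = 49 := discr_K49 hK3 ht
  have hb := hC (cubeCurve u v) K (cubeCurve_irreducible huv) hK3 ⟨_, cubeCurve_root ht u v⟩
    (by rw [hd]; norm_num)
  rw [hd] at hb
  have h49 : |((49 : ℤ) : ℝ)| = 49 := by norm_num
  rw [h49] at hb
  have hΔ : (w.natAbs : ℝ) ^ (6 : ℕ) ≤ ((cubeCurve u v).minimalDiscriminantNorm ℤ : ℝ) := by
    exact_mod_cast minimalDiscriminantNorm_ge huv h
  have hN : ((cubeCurve u v).conductorNorm ℤ : ℝ) ≤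
      (3048192 : ℝ) * ((UniqueFactorizationMonoid.radical w.natAbs : ℕ) : ℝ) := by
    have := conductorNorm_le huv h hw
    have hA : (2 : ℕ) ^ 8 * 3 ^ 5 * 7 ^ 2 = 3048192 := by norm_num
    rw [hA] at this
    exact_mod_cast this
  have hw1 : (1 : ℝ) ≤ (w.natAbs : ℝ) := by exact_mod_cast Int.natAbs_pos.mpr hw
  have hΔ1 : (1 : ℝ) ≤ ((cubeCurve u v).minimalDiscriminantNorm ℤ : ℝ) :=
    le_trans (by simpa using pow_le_pow_left₀ zero_le_one hw1 6) hΔ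
  have hNκ : 0 ≤ ((cubeCurve u v).conductorNorm ℤ : ℝ) ^ κ := Real.rpow_nonneg (Nat.cast_nonneg _) _
  have hC0 : 0 ≤ C := by
    by_contra hneg
    push_neg at hneg
    have : C * 49 * ((cubeCurve u v).conductorNorm ℤ : ℝ) ^ κ ≤ 0 :=
      mul_nonpos_of_nonpos_of_nonneg (by linarith) hNκ
    linarith
  refine ⟨hC0, ?_⟩
  calc (w.natAbs : ℝ) ^ (6 : ℕ) ≤ ((cubeCurve u v).minimalDiscriminantNorm ℤ : ℝ) := hΔ
    _ ≤ C * 49 * ((cubeCurve u v).conductorNorm ℤ : ℝ) ^ κ := hb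
    _ ≤ C * 49 * ((3048192 : ℝ) * ((UniqueFactorizationMonoid.radical w.natAbs : ℕ) : ℝ)) ^ κ :=
        mul_le_mul_of_nonneg_left (Real.rpow_le_rpow (Nat.cast_nonneg _) hN hκ) (mul_nonneg hC0 (by norm_num))

/-- **T1. The exponent `6` is sharp inside `ℚ(ζ₇)⁺`:** `¬ IndexSzpiroRealExp κ` for every `κ < 6`. -/
theorem not_indexSzpiroRealExp_of_lt_six {κ : ℝ} (hκ : κ < 6) : ¬ IndexSzpiroRealExp κ := by
  intro hyp
  -- w.l.o.g. `0 ≤ κ` (monotonicity)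
  obtain ⟨κ', hκ'0, hκ'6, hle⟩ : ∃ κ' : ℝ, 0 ≤ κ' ∧ κ' < 6 ∧ κ ≤ κ' :=
    ⟨max κ 0, le_max_right _ _, max_lt hκ (by norm_num), le_max_left _ _⟩
  obtain ⟨C, hC⟩ := indexSzpiroRealExp_mono hle hyp
  have h6 : 0 < 6 - κ' := by linarith
  -- `B` with `C·49·A^κ' < x^(6-κ')` for all real `x ≥ B`
  obtain ⟨x₀, hx₀⟩ := ((tendsto_rpow_atTop h6).eventually_gt_atTop
    (C * 49 * (3048192 : ℝ) ^ κ')).exists_forall_of_atTop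
  obtain ⟨B, hB⟩ := exists_nat_ge x₀
  obtain ⟨u, v, w, huv, h, hwB⟩ := cubePoints_unbounded B
  have hw : w ≠ 0 := by
    rintro rfl
    simp only [abs_zero] at hwB
    exact absurd hwB (not_lt.mpr (by positivity))
  obtain ⟨hC0, hfam⟩ := family_bound hκ'0 hC huv h hw
  have hx0 : (0 : ℝ) < (w.natAbs : ℝ) := by exact_mod_cast Int.natAbs_pos.mpr hw
  have hBw : B ≤ w.natAbs := by
    have h1 : (B : ℤ) ≤ (w.natAbs : ℤ) := by rw [Int.natCast_natAbs]; exact hwB.le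
    exact_mod_cast h1
  have hxB : x₀ ≤ (w.natAbs : ℝ) := hB.trans (by exact_mod_cast hBw)
  have hrad : ((UniqueFactorizationMonoid.radical w.natAbs : ℕ) : ℝ) ≤ (w.natAbs : ℝ) := by
    exact_mod_cast Nat.le_of_dvd (Int.natAbs_pos.mpr hw)
      (UniqueFactorizationMonoid.radical_dvd_self (a := w.natAbs))
  have hkey := hx₀ _ hxB        -- C * 49 * 3048192 ^ κ' < |w| ^ (6 - κ')
  -- |w|^6 ≤ C·49·(A·rad w)^κ' ≤ (C·49·A^κ')·|w|^κ' < |w|^(6-κ')·|w|^κ' = |w|^6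
  have h2 : C * 49 * ((3048192 : ℝ) * ((UniqueFactorizationMonoid.radical w.natAbs : ℕ) : ℝ)) ^ κ' ≤
      (C * 49 * (3048192 : ℝ) ^ κ') * (w.natAbs : ℝ) ^ κ' := by
    rw [mul_assoc (C * 49), ← Real.mul_rpow (by norm_num) hx0.le]
    exact mul_le_mul_of_nonneg_left
      (Real.rpow_le_rpow (by positivity) (mul_le_mul_of_nonneg_left hrad (by norm_num)) hκ'0)
      (mul_nonneg hC0 (by norm_num))
  have h3 : (C * 49 * (3048192 : ℝ) ^ κ') * (w.natAbs : ℝ) ^ κ' <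
      (w.natAbs : ℝ) ^ (6 - κ') * (w.natAbs : ℝ) ^ κ' :=
    mul_lt_mul_of_pos_right hkey (Real.rpow_pos_of_pos hx0 _)
  have h4 : (w.natAbs : ℝ) ^ (6 - κ') * (w.natAbs : ℝ) ^ κ' = (w.natAbs : ℝ) ^ (6 : ℕ) := by
    rw [← Real.rpow_add hx0, show (6 : ℝ) - κ' + κ' = ((6 : ℕ) : ℝ) by push_cast; ring,
      Real.rpow_natCast]
  linarith [hfam.trans h2]

/-- **T2. `ε` cannot be dropped inside `ℚ(ζ₇)⁺`:** `¬ IndexSzpiroRealExp 6` (from the `29`-powerful members H7). -/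
theorem not_indexSzpiroRealExp_six : ¬ IndexSzpiroRealExp 6 := by
  rintro ⟨C, hC⟩
  -- `k` with `C·49·A^6 < (29^k)^6`
  obtain ⟨k, hk⟩ : ∃ k : ℕ, C * 49 * (3048192 : ℝ) ^ (6 : ℕ) < ((29 : ℝ) ^ k) ^ (6 : ℕ) := by
    obtain ⟨k, hk⟩ := pow_unbounded_of_one_lt (C * 49 * (3048192 : ℝ) ^ (6 : ℕ))
      (by norm_num : (1 : ℝ) < 29 ^ 6)
    exact ⟨k, hk.trans_eq (by rw [← pow_mul, ← pow_mul, mul_comm])⟩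
  obtain ⟨u, v, w, huv, h, hw, hpow⟩ := cubePoints_powerful k
  obtain ⟨hC0, hfam⟩ := family_bound (by norm_num : (0 : ℝ) ≤ 6) hC huv h hw
  rw [show (6 : ℝ) = ((6 : ℕ) : ℝ) by norm_num, Real.rpow_natCast] at hfam
  have hx0 : (0 : ℝ) < (w.natAbs : ℝ) := by exact_mod_cast Int.natAbs_pos.mpr hw
  have hr0 : (0 : ℝ) < ((UniqueFactorizationMonoid.radical w.natAbs : ℕ) : ℝ) := by
    exact_mod_cast Nat.pos_of_ne_zero (UniqueFactorizationMonoid.radical_ne_zero (a := w.natAbs))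
  have hpow' : (29 : ℝ) ^ k * ((UniqueFactorizationMonoid.radical w.natAbs : ℕ) : ℝ) ≤ (w.natAbs : ℝ) := by
    exact_mod_cast hpow
  -- (29^k)^6·|w|^6 ≤ (29^k)^6·C·49·A^6·rad^6 = C·49·A^6·(29^k·rad)^6 ≤ C·49·A^6·|w|^6 < (29^k)^6·|w|^6
  have h1 : ((29 : ℝ) ^ k) ^ (6 : ℕ) * (w.natAbs : ℝ) ^ (6 : ℕ) ≤
      C * 49 * (3048192 : ℝ) ^ (6 : ℕ) *
        ((29 : ℝ) ^ k * ((UniqueFactorizationMonoid.radical w.natAbs : ℕ) : ℝ)) ^ (6 : ℕ) := by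
    have := mul_le_mul_of_nonneg_left hfam (by positivity : (0 : ℝ) ≤ ((29 : ℝ) ^ k) ^ (6 : ℕ))
    refine this.trans_eq ?_
    ring
  have h2 : C * 49 * (3048192 : ℝ) ^ (6 : ℕ) *
        ((29 : ℝ) ^ k * ((UniqueFactorizationMonoid.radical w.natAbs : ℕ) : ℝ)) ^ (6 : ℕ) ≤
      C * 49 * (3048192 : ℝ) ^ (6 : ℕ) * (w.natAbs : ℝ) ^ (6 : ℕ) :=
    mul_le_mul_of_nonneg_left (pow_le_pow_left₀ (by positivity) hpow' 6)
      (mul_nonneg (mul_nonneg hC0 (by norm_num)) (by positivity))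
  have h3 : C * 49 * (3048192 : ℝ) ^ (6 : ℕ) * (w.natAbs : ℝ) ^ (6 : ℕ) <
      ((29 : ℝ) ^ k) ^ (6 : ℕ) * (w.natAbs : ℝ) ^ (6 : ℕ) :=
    mul_lt_mul_of_pos_right hk (by positivity)
  linarith

/-- **T3. What the stub asserts, exactly:** unconditionally `IndexSzpiroRealExp κ → 6 < κ`; the stub is
the converse.  (So the stub pins the threshold exponent of the real irreducible class AT `6`.) -/
theorem six_lt_of_indexSzpiroRealExp {κ : ℝ} (h : IndexSzpiroRealExp κ) : 6 < κ := by
  by_contra hle; push_neg at hle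
  rcases hle.lt_or_eq with hlt | heq
  · exact not_indexSzpiroRealExp_of_lt_six hlt h
  · exact not_indexSzpiroRealExp_six (heq ▸ h)

theorem stub_iff_threshold : StubRealCubic ↔ ∀ κ : ℝ, IndexSzpiroRealExp κ ↔ 6 < κ := by
  rw [stub_iff]
  constructor
  · intro hs κ
    refine ⟨six_lt_of_indexSzpiroRealExp, fun hκ => ?_⟩
    have := hs (κ - 6) (by linarith)
    simpa using this
  · intro h ε hε
    exact (h (6 + ε)).mpr (by linarith)

/-! ## §4 The residual, localised (informal): on the saturating family the stub reads
`∀ ε>0 ∃C, ∀ m, 3 ∤ m → log e_m ≤ (1+ε)·log rad(e_m) + C` for the EDS `(e_m)` of `γ₁ = (84,756)` on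
`y² = x³ − 21168` — an `abc`-type quasi-radical statement for ONE elliptic divisibility sequence. -/

end Summit.ABC.ABC.Cruxes.IndexSzpiro.StubIdeas3G4
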